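import Literature.RepresentationTheory.Kovacevic2021.SU21CasimirVanishing
import Literature.RepresentationTheory.Kovacevic2021.SU21CohomologyAllDegrees
import HarnessLib

/-!
# Irreducible `K`-type data for `SU(2,1)`: the Casimir is a scalar, and a cohomological datum has
# Casimir `0` and contains one of the six `K`-types of `Λ^•𝔭`

Continuation of `Literature.RepresentationTheory.Kovacevic2021.SU21Casimir` / `SU21CasimirCentral`
(the Casimir `Ω = ∑ ρ(E_{ij})ρ(E_{ji})` of a datum `𝒟 : SU21Datum` acts on the `K`-type `V_{n,m}` by the
scalar `casimirScalar n m`, and commutes with `𝔤𝔩(3,ℂ)`), `SU21CasimirVanishing` (a non-zero scalar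
Casimir kills `H^•(𝔤𝔩₃, 𝔨; V)`, Borel–Wallach II 3.1 (a)) and `SU21RelativeCochainsDegree*` /
`SU21CohomologyDegree*` (`C^q(𝔤𝔩₃, 𝔨; V) ≅` products of the highest-weight lines of the `K`-types
`V_{1,0}` (`q = 0, 2, 4`), `V_{2,±3}` (`q = 1, 3`), `V_{1,±6}, V_{3,0}` (`q = 2`); `C^q = 0` for `q ≥ 5`).

Sources.  [BorelWallach2000, I 5.3 / II Cor. 3.3 ("Wigner's lemma"), p. 36]: an irreducible module with
non-zero relative Lie algebra cohomology has the infinitesimal character of the trivial representation —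
in particular its Casimir vanishes; [BorelWallach2000, VI 4.8 (3),(5), Lemma 4.9, p. 131]: `Λ^q(𝔤_c/𝔨_c)`
for `SU(2,1)` is the sum of the `K`-types `F_{p,q}` = `V_{1,0}, V_{2,3}, V_{2,-3}, V_{1,6}, V_{3,0}, V_{1,-6}`
(dictionary of `SU21ModulesFromKTypes`); [Kovacevic2021, §3 Thm 2, Remark 3]: on an irreducible module the
products `a d'`, `b c'` and the `K`-types determine everything, the Casimir being a fixed scalar.

## What is proved (theorems only; no definitions, no named facts)

For a datum `𝒟` whose module `𝒟.V` is an irreducible `𝔤𝔩(3,ℂ)`-module (Mathlib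
`LieModule.IsIrreducible`):
* `nonempty_S_of_isIrreducible`: `S ≠ ∅`;
* `exists_casimir_eq_smul_one_of_isIrreducible` (Schur/Dixmier for the Casimir, proved directly): `Ω = c·1`
  for some `c` — the `c`-eigenspace of `Ω` for the eigenvalue met on one `K`-type is a non-zero Lie
  submodule (`Ω` commutes with the action), hence everything;
* `casimirScalar_eq_of_isIrreducible`: consequently `casimirScalar n m` takes one value on `S`;
* `casimirScalar_eq_zero_of_isIrreducible_of_finrank_relCohomology_ne_zero`: if moreover
  `dim H^q(𝔤𝔩₃, 𝔨; V) ≠ 0` for some `q`, then `casimirScalar n m = 0` for every `K`-type `(n,m) ∈ S`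
  (the equation "`Ω = 0`" that the classification `SU21CohomologicalClassification` solves together with
  (b20), (b25));
and, for an arbitrary datum, `exists_fLabel_mem_of_finrank_relCohomology_ne_zero`: `dim H^q ≠ 0` for some
`q` forces one of `(1,0), (2,3), (2,-3), (1,6), (1,-6), (3,0)` to be a `K`-type (else every `C^q = 0`).

## References

* A. Borel, N. Wallach (2000), I 5.3, II Prop. 3.1, Cor. 3.3 pp. 36–37; VI 4.8–4.9 p. 131, Thm 4.11 (1)
  p. 132. [BorelWallach2000]
* D. Kovačević, Acta Math. Spalatensia 1 (2021) 105–125 (arXiv:1810.01752), §3 Thm 2, Remark 3.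
  [Kovacevic2021]
-/

noncomputable section

open Module
open Literature.Algebra.Lie Literature.Algebra.Lie.ChevalleyEilenberg

namespace Literature.RepresentationTheory.Kovacevic2021

-- Mathlib idiom (Mathlib/Algebra/Lie/OfAssociative.lean): commutator brackets on associative algebras.
attribute [local instance 100] LieRing.ofAssociativeRing

namespace SU21Datum

variable (𝒟 : SU21Datum)

/-! ## §1 The Casimir of an irreducible datum is a scalar -/

/-- An irreducible datum has a `K`-type (the module `V` is non-trivial, and `V` is spanned by the basis
vectors `u^k_{n,m}`, `(n,m) ∈ S`). [cite: Kovacevic2021, §3 Def 1, Thm 2] -/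
theorem nonempty_S_of_isIrreducible [hirr : LieModule.IsIrreducible ℂ gl3 𝒟.V] : 𝒟.S.Nonempty := by
  have hnt : (⊥ : LieSubmodule ℂ gl3 𝒟.V) ≠ ⊤ := hirr.toNontrivial.rec fun _ => bot_ne_top
  by_contra hS
  rw [Set.not_nonempty_iff_eq_empty] at hS
  apply hnt
  rw [← LieSubmodule.toSubmodule_inj, LieSubmodule.bot_toSubmodule, LieSubmodule.top_toSubmodule,
    ← iSup_Ktype, eq_comm, iSup_eq_bot]
  rintro ⟨n, m⟩
  exact 𝒟.Ktype_eq_bot (by rw [hS]; exact Set.notMem_empty _)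

/-- **The Casimir of an irreducible datum is a scalar** (`Ω = c · 1`): the eigenspace of `Ω` for the
eigenvalue `c_{n₀,m₀}` met on a `K`-type `V_{n₀,m₀}` is a Lie submodule (`Ω` commutes with `𝔤𝔩(3,ℂ)`),
non-zero, hence all of `V`. [cite: BorelWallach2000, II §2.3, §2.5 pp. 34–36] [cite: Kovacevic2021, §3 Remark 3] -/
theorem exists_casimir_eq_smul_one_of_isIrreducible [hirr : LieModule.IsIrreducible ℂ gl3 𝒟.V] :
    ∃ c : ℂ, 𝒟.casimir = c • (1 : Module.End ℂ 𝒟.V) := by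
  obtain ⟨⟨n₀, m₀⟩, h₀⟩ := 𝒟.nonempty_S_of_isIrreducible
  refine ⟨𝒟.casimirScalar n₀ m₀, ?_⟩
  set c := 𝒟.casimirScalar n₀ m₀ with hc
  -- the `c`-eigenspace of `Ω` as a Lie submodule
  let N : LieSubmodule ℂ gl3 𝒟.V :=
    { (LinearMap.ker (𝒟.casimir - c • (1 : Module.End ℂ 𝒟.V)) : Submodule ℂ 𝒟.V) with
      lie_mem := by
        intro M v hv
        simp only [Submodule.mem_carrier, SetLike.mem_coe, LinearMap.mem_ker, LinearMap.sub_apply,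
          LinearMap.smul_apply, Module.End.one_apply, sub_eq_zero] at hv ⊢
        rw [casimir_lie, hv, lie_smul] }
  have hmem : ∀ v : 𝒟.V, v ∈ N ↔ 𝒟.casimir v = c • v := fun v => by
    change v ∈ LinearMap.ker (𝒟.casimir - c • (1 : Module.End ℂ 𝒟.V)) ↔ _
    rw [LinearMap.mem_ker, LinearMap.sub_apply, LinearMap.smul_apply, Module.End.one_apply, sub_eq_zero]
  have hN : N ≠ ⊥ := by
    intro hbot
    have hv : 𝒟.vec n₀ m₀ 1 ∈ N := (hmem _).2 (𝒟.casimir_vec h₀ le_rfl (𝒟.one_le_of_mem h₀))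
    rw [hbot, LieSubmodule.mem_bot] at hv
    exact 𝒟.vec_ne_zero ⟨h₀, le_rfl, 𝒟.one_le_of_mem h₀⟩ hv
  have hN' : N = ⊤ := (hirr.eq_bot_or_eq_top N).resolve_left hN
  refine LinearMap.ext fun v => ?_
  rw [LinearMap.smul_apply, Module.End.one_apply]
  exact (hmem v).1 (hN' ▸ LieSubmodule.mem_top v)

/-- On an irreducible datum the `K`-type scalar `c_{n,m}` of `Ω` (`SU21Casimir.casimirScalar`, the raw form
`(n²−1)/2 + m²/6 + (n+1)(A D' + B C') + (n−1)(D A'' + C B'')`) takes one and the same value on all of `S`.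
[cite: Kovacevic2021, §3 Remark 3] [cite: BorelWallach2000, II §2.5 p. 36] -/
theorem casimirScalar_eq_of_isIrreducible [LieModule.IsIrreducible ℂ gl3 𝒟.V] :
    ∃ c : ℂ, 𝒟.casimir = c • (1 : Module.End ℂ 𝒟.V) ∧ ∀ n m : ℤ, (n, m) ∈ 𝒟.S → 𝒟.casimirScalar n m = c := by
  obtain ⟨c, hc⟩ := 𝒟.exists_casimir_eq_smul_one_of_isIrreducible
  refine ⟨c, hc, fun n m hS => ?_⟩
  have h1 := 𝒟.casimir_vec hS le_rfl (𝒟.one_le_of_mem hS)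
  rw [hc, LinearMap.smul_apply, Module.End.one_apply] at h1
  have hv := 𝒟.vec_ne_zero ⟨hS, le_rfl, 𝒟.one_le_of_mem hS⟩
  exact (smul_left_injective ℂ hv h1).symm

/-! ## §2 Cohomological data: Casimir `0` and an `F`-label among the `K`-types -/

/-- **Wigner for irreducible data.** If `V` is irreducible and `dim H^q(𝔤𝔩₃, 𝔨; V) ≠ 0` for some `q`,
then the Casimir vanishes on every `K`-type: `casimirScalar n m = 0` for all `(n,m) ∈ S`.
[cite: BorelWallach2000, I 5.3 (ii), II Cor. 3.3 p. 37, VI Thm 4.11 (1) p. 132] -/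
theorem casimirScalar_eq_zero_of_isIrreducible_of_finrank_relCohomology_ne_zero
    [LieModule.IsIrreducible ℂ gl3 𝒟.V] {q : ℕ} (hq : finrank ℂ (relCohomology ℂ gl3 𝒟.V kSub q) ≠ 0)
    {n m : ℤ} (hS : (n, m) ∈ 𝒟.S) : 𝒟.casimirScalar n m = 0 := by
  obtain ⟨c, hc, hall⟩ := 𝒟.casimirScalar_eq_of_isIrreducible
  rw [hall n m hS]
  exact 𝒟.casimir_scalar_eq_zero_of_finrank_relCohomology_ne_zero hc hq

/-- The Casimir of an irreducible cohomological datum is the zero operator.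
[cite: BorelWallach2000, I 5.3 (ii), II Cor. 3.3 p. 37] -/
theorem casimir_eq_zero_of_isIrreducible_of_finrank_relCohomology_ne_zero
    [LieModule.IsIrreducible ℂ gl3 𝒟.V] {q : ℕ} (hq : finrank ℂ (relCohomology ℂ gl3 𝒟.V kSub q) ≠ 0) :
    𝒟.casimir = 0 := by
  obtain ⟨c, hc, -⟩ := 𝒟.casimirScalar_eq_of_isIrreducible
  rw [hc, 𝒟.casimir_scalar_eq_zero_of_finrank_relCohomology_ne_zero hc hq, zero_smul]

/-- **The `K`-types of `Λ^•𝔭` must occur.** For ANY datum: if `dim H^q(𝔤𝔩₃, 𝔨; V) ≠ 0` for some `q`, then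
one of `V_{1,0}` (`F_{0,0}`), `V_{2,3}` (`F_{1,0}`), `V_{2,−3}` (`F_{0,1}`), `V_{1,6}` (`F_{2,0}`), `V_{1,−6}`
(`F_{0,2}`), `V_{3,0}` (`F_{1,1}`) is a `K`-type of `V` — otherwise every `C^q(𝔤𝔩₃, 𝔨; V)` vanishes.
[cite: BorelWallach2000, VI 4.8 (3),(5), Lemma 4.9 (1) p. 131, Thm 4.11 (9) p. 132] -/
theorem exists_fLabel_mem_of_finrank_relCohomology_ne_zero {q : ℕ}
    (hq : finrank ℂ (relCohomology ℂ gl3 𝒟.V kSub q) ≠ 0) :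
    ((1 : ℤ), (0 : ℤ)) ∈ 𝒟.S ∨ ((2 : ℤ), (3 : ℤ)) ∈ 𝒟.S ∨ ((2 : ℤ), (-3 : ℤ)) ∈ 𝒟.S ∨
      ((1 : ℤ), (6 : ℤ)) ∈ 𝒟.S ∨ ((1 : ℤ), (-6 : ℤ)) ∈ 𝒟.S ∨ ((3 : ℤ), (0 : ℤ)) ∈ 𝒟.S := by
  by_contra h
  push Not at h
  obtain ⟨h10, h23, h2m3, h16, h1m6, h30⟩ := h
  apply hq
  apply 𝒟.finrank_relCohomology_eq_zero q
  rcases Nat.lt_or_ge q 5 with hq5 | hq5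
  · interval_cases q
    · exact 𝒟.relCochain_zero_eq_bot h10
    · exact 𝒟.relCochain_one_eq_bot h23 h2m3
    · exact 𝒟.relCochain_two_eq_bot h16 h30 h10 h1m6
    · exact 𝒟.relCochain_three_eq_bot h23 h2m3
    · exact 𝒟.relCochain_four_eq_bot h10
  · exact 𝒟.relCochain_eq_bot_of_five_le hq5

/-- Combined form used by the classification: an irreducible datum with some `dim H^q ≠ 0` has Casimir
scalar `0` on all of `S` AND contains one of the six `F`-labels.
[cite: BorelWallach2000, VI Thm 4.11 (1) p. 132 (first step of the proof)] -/
theorem cohomological_input [LieModule.IsIrreducible ℂ gl3 𝒟.V] {q : ℕ}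
    (hq : finrank ℂ (relCohomology ℂ gl3 𝒟.V kSub q) ≠ 0) :
    (∀ n m : ℤ, (n, m) ∈ 𝒟.S → 𝒟.casimirScalar n m = 0) ∧
      (((1 : ℤ), (0 : ℤ)) ∈ 𝒟.S ∨ ((2 : ℤ), (3 : ℤ)) ∈ 𝒟.S ∨ ((2 : ℤ), (-3 : ℤ)) ∈ 𝒟.S ∨
        ((1 : ℤ), (6 : ℤ)) ∈ 𝒟.S ∨ ((1 : ℤ), (-6 : ℤ)) ∈ 𝒟.S ∨ ((3 : ℤ), (0 : ℤ)) ∈ 𝒟.S) :=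
  ⟨fun _ _ hS => 𝒟.casimirScalar_eq_zero_of_isIrreducible_of_finrank_relCohomology_ne_zero hq hS,
    𝒟.exists_fLabel_mem_of_finrank_relCohomology_ne_zero hq⟩

end SU21Datum

end Literature.RepresentationTheory.Kovacevic2021
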